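import Mathlib.Combinatorics.SimpleGraph.Walk.Counting
import Mathlib.Combinatorics.SimpleGraph.Paths
import Mathlib.Topology.Algebra.InfiniteSum.ENNReal
import Summits.CriticalPhenomena.SAWScalingLimit.Theorems.SAWTotalPositivityBoundaryTP2Defs
import HarnessLib

/-!
# Crux `BoundaryTP2` (stmt-CriticalPhenomena-7115), line `Sketch`: first-step decomposition of the path kernel

For the fugacity-`x` self-avoiding path kernel `Z(a,b) = pathKernel H x a b = Σ_{γ : a → b} x^{|γ|}`
(an `ℝ≥0∞`-valued `tsum` over Mathlib's `SimpleGraph.Path`) and `a ≠ b`, decomposing a self-avoiding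
path `a → b` according to its first edge `a ∼ u` gives

`Z(a,b) = x · Σ_{u ∼ a} Σ_{γ : u → b self-avoiding, a ∉ γ} x^{|γ|}`,

i.e. `pathKernel H x a b = ENNReal.ofReal x * ∑' u : H.neighborSet a, pathKernelOn H x u b {γ | a ∉ γ.support}`
(`stub_pathKernel_firstStep`, the registered stub of the line's skeleton). The proof is the bijection
`(u, γ) ↦ a·γ` between pairs (neighbour `u` of `a`, self-avoiding `γ : u → b` avoiding `a`) and
self-avoiding paths `a → b` (`SimpleGraph.Walk.cons_isPath_iff`; the trivial path is excluded by `a ≠ b`),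
transported along `Function.Injective.tsum_eq`, then `ENNReal.tsum_sigma'`, `tsum_subtype` and
`ENNReal.tsum_mul_left`. No finiteness of `H` is needed (all sums are unconditional in `ℝ≥0∞`);
`0 ≤ x` is needed only to split `ENNReal.ofReal (x * x^n)`.

Everything here is proved; no named facts are used. [folklore]
-/

noncomputable section

namespace Summit.CriticalPhenomena.SAWScalingLimit.Theorems.BoundaryTP2

open scoped ENNReal

variable {V : Type*}

/-- The "prepend the first edge" map `(u, γ) ↦ a·γ`, from pairs consisting of a neighbour `u` of `a` and a
self-avoiding path `γ : u → b` avoiding `a` to self-avoiding paths `a → b`, is injective. [folklore] -/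
private theorem consPath_injective (H : SimpleGraph V) (a b : V) :
    Function.Injective
      (fun p : (Σ u : H.neighborSet a, {γ : H.Path u b // a ∉ γ.1.support}) =>
        (⟨SimpleGraph.Walk.cons p.1.2 p.2.1.1,
          (SimpleGraph.Walk.cons_isPath_iff p.1.2 p.2.1.1).2 ⟨p.2.1.2, p.2.2⟩⟩ : H.Path a b)) := by
  rintro ⟨⟨u, hu⟩, ⟨⟨q, hq⟩, hqa⟩⟩ ⟨⟨u', hu'⟩, ⟨⟨q', hq'⟩, hqa'⟩⟩ h
  simp only [Subtype.mk.injEq, SimpleGraph.Walk.cons.injEq] at h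
  obtain ⟨rfl, h⟩ := h
  obtain rfl := heq_iff_eq.mp h
  rfl

/-- For `a ≠ b` the "prepend the first edge" map `(u, γ) ↦ a·γ` is surjective: a self-avoiding path
`a → b` is not trivial, so it is `a·γ` for its first edge `a ∼ u` and a self-avoiding `γ : u → b` that
avoids `a` (`SimpleGraph.Walk.cons_isPath_iff`). [folklore] -/
private theorem consPath_surjective (H : SimpleGraph V) {a b : V} (hab : a ≠ b) :
    Function.Surjective
      (fun p : (Σ u : H.neighborSet a, {γ : H.Path u b // a ∉ γ.1.support}) =>
        (⟨SimpleGraph.Walk.cons p.1.2 p.2.1.1,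
          (SimpleGraph.Walk.cons_isPath_iff p.1.2 p.2.1.1).2 ⟨p.2.1.2, p.2.2⟩⟩ : H.Path a b)) := by
  rintro ⟨w, hw⟩
  cases w with
  | nil => exact absurd rfl hab
  | cons h q =>
    exact ⟨⟨⟨_, h⟩, ⟨q, ((SimpleGraph.Walk.cons_isPath_iff h q).1 hw).1⟩,
      ((SimpleGraph.Walk.cons_isPath_iff h q).1 hw).2⟩, rfl⟩

/-- **First-step decomposition of the self-avoiding path kernel.** For `a ≠ b` and `0 ≤ x`,
`Z(a,b) = x · Σ_{u ∼ a} Σ_{γ : u → b self-avoiding, a ∉ γ} x^{|γ|}`: a self-avoiding path from `a ≠ b`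
is `a·γ` for a unique neighbour `u` of `a` and a unique self-avoiding `γ : u → b` not visiting `a`, and
`x^{|a·γ|} = x · x^{|γ|}`. All sums are unconditional sums in `ℝ≥0∞`; no finiteness of `H` is needed.
[folklore] -/
theorem stub_pathKernel_firstStep (H : SimpleGraph V) (x : ℝ) (hx : 0 ≤ x) (a b : V) (hab : a ≠ b) :
    pathKernel H x a b =
      ENNReal.ofReal x * ∑' u : H.neighborSet a, pathKernelOn H x u b {γ | a ∉ γ.1.support} := by
  -- each inner restricted kernel is a sum over the subtype of paths avoiding `a`
  have hsub : ∀ u : H.neighborSet a, pathKernelOn H x u b {γ | a ∉ γ.1.support} =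
      ∑' γ : {γ : H.Path u b // a ∉ γ.1.support}, ENNReal.ofReal (x ^ γ.1.1.length) := fun u =>
    (tsum_subtype {γ : H.Path u b | a ∉ γ.1.support} (fun γ => ENNReal.ofReal (x ^ γ.1.length))).symm
  calc pathKernel H x a b
      = ∑' p : (Σ u : H.neighborSet a, {γ : H.Path u b // a ∉ γ.1.support}),
          ENNReal.ofReal (x ^ (SimpleGraph.Walk.cons p.1.2 p.2.1.1).length) :=
        ((consPath_injective H a b).tsum_eq (f := fun γ : H.Path a b => ENNReal.ofReal (x ^ γ.1.length))
          fun γ _ => consPath_surjective H hab γ).symm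
    _ = ∑' p : (Σ u : H.neighborSet a, {γ : H.Path u b // a ∉ γ.1.support}),
          ENNReal.ofReal x * ENNReal.ofReal (x ^ p.2.1.1.length) := by
        refine tsum_congr fun p => ?_
        rw [SimpleGraph.Walk.length_cons, pow_succ', ENNReal.ofReal_mul hx]
    _ = ENNReal.ofReal x * ∑' p : (Σ u : H.neighborSet a, {γ : H.Path u b // a ∉ γ.1.support}),
          ENNReal.ofReal (x ^ p.2.1.1.length) := ENNReal.tsum_mul_left
    _ = ENNReal.ofReal x * ∑' u : H.neighborSet a,
          ∑' γ : {γ : H.Path u b // a ∉ γ.1.support}, ENNReal.ofReal (x ^ γ.1.1.length) := by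
        rw [ENNReal.tsum_sigma'
          (fun p : (Σ u : H.neighborSet a, {γ : H.Path u b // a ∉ γ.1.support}) =>
            ENNReal.ofReal (x ^ p.2.1.1.length))]
    _ = ENNReal.ofReal x * ∑' u : H.neighborSet a, pathKernelOn H x u b {γ | a ∉ γ.1.support} := by
        rw [tsum_congr hsub]

end Summit.CriticalPhenomena.SAWScalingLimit.Theorems.BoundaryTP2
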